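/-
COR-CM (cell pub-hodgecm2, stage 2 of the Hodge ladder) — count-neutral KERNEL COMBINATORICS «the named cyclotomic fields»
(seat prover-pub-hodgecm2-b23-g39-0, binder prover b23, gen 39; claim CYCLIC-FIELDS F3, HOME/INBOX.md l.9351).  Theorems only: instances of
`CorCM/FaceCyclicGaloisGroup.lean` (F1) and `CorCM/FaceCyclicBlockNumerals.lean` (F2) of this lane; the INT2-GEN socket, seat b09's floors and
gen 38's `FaceCyclicGeneration` enter BY NAME through them; no geometry, no named fact, nothing asserted; `Interfaces.lean` (C1), every E term,
B01 and `Transposition/*` are untouched.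
HONEST FRAMING (COORDINATOR RULING — HODGE FRAMING CORRECTION, 2026-08-21T11:55:35Z): `HC_CM` is NOT proved, here or anywhere in the
tree; this file produces no period and proves no face period for any field; every `HodgeConjectureFor` below is CONDITIONAL on face periods.
T5: n/a-class — the only Prop hypothesis binder displayed is INT2-GEN's period hypothesis on the produced face set; no named-fact /
conjecture-def binder; checker: self (prover-pub-hodgecm2-b23-g39-0), 2026-08-22.
-/
import Summits.HodgeConjecture.CorCM.FaceCyclicGaloisGroup
import Summits.HodgeConjecture.CorCM.FaceCyclicBlockNumerals
import HarnessLib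

/-!
# The named cyclotomic CM fields: block numbers, exact face counts, and the conditional Hodge reading

This file: the prime cyclotomic fields `ℚ(ζ₇)` (degree 6, `β = 2`, 1 face), `ℚ(ζ₁₁)` (10, 4, 3), `ℚ(ζ₁₃)` (12, 6, 5), `ℚ(ζ₁₇)` (16, 16, 15),
`ℚ(ζ₁₉)` (18, 30, 29), `ℚ(ζ₂₃)` (22, 94, 93).

For each field `K` (ANY CM field that is an `n`-th cyclotomic extension of `ℚ` — the field seat supplies `⟨CyclotomicField n ℚ⟩` with
Mathlib's `IsCyclotomicExtension.Rat.isCMField`) three kernel theorems, all instance-binder free: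
* `card_block_galT_cyclotomic_<n>` — the number `β(K)` of blocks of abstract CM types of `GalT K` (↔ the simple CM isogeny classes split
  by `K`, [Milne1999, Prop. 2.1]), from F1's cyclic `GalT` + F2's numerals of b09's closed form;
* `isLeast_card_faces_hgen_cyclotomic_<n>` — the least number of rank-four faces of `K` whose Weil characters at all base embeddings
  generate those of every face (INT2-GEN's `hgen(𝒮, σ₀)`) is EXACTLY `β(K) − 1`, for every base embedding `σ₀` (gen 38's
  `isLeast_card_faces_hgen_of_isCyclic` through F2);
* `hodgeConjectureFor_cyclotomic_<n>_of_exists_facePeriod` — a face set of exactly `β(K) − 1` faces EXISTS such that, IF each has a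
  non-vanishing period on the universe of record, THEN the Hodge conjecture holds in every codimension for every complex abelian variety
  dominated by a product of CM abelian varieties with CM by subfields of `K` (among them all powers and products of the simple CM abelian
  varieties of Fermat type attached to `K`) — CONDITIONAL; `HC_CM` is NOT proved, no period is produced.
The fields `ℚ(ζ₂₉)`, `ℚ(ζ₃₁)`, `ℚ(ζ₉)`, `ℚ(ζ₂₅)`, `ℚ(ζ₂₇)` are the companion file `CorCM/FaceCyclotomicFieldsB.lean`.

References: [cite: Washington1997, Thm. 2.5, Prop. 2.7]; [cite: Pohlmann1968, Thm. 1]; [cite: Milne1999LefschetzClasses, Thm. 3.2, Prop. 2.1];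
[cite: Shimura1998, §6.2 Theorem 3 and §6.1 Corollary of Theorem 2 (pp. 41–43), §8.1 (p. 62)]; [cite: MumfordAV1970, §19 Thm. 1 and p. 169].
-/

noncomputable section

open CategoryTheory NumberField NumberField.ComplexEmbedding
open Literature.AlgebraicGeometry Literature.AlgebraicGeometry.Motives Literature.AlgebraicGeometry.HodgeTheory
open Literature.AlgebraicGeometry.ComplexMultiplication Literature.AlgebraicGeometry.Milne1999
open Literature.NumberTheory.Automorphic
open Literature.NumberTheory.Automorphic.PicardCM
open Summit.HodgeConjecture.CorCM.Domination

namespace Summit.HodgeConjecture.CorCM.FaceCyclic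

open Summit.HodgeConjecture.CorCM.Prior.AllgGroup.RfwfAllgGroup
open Summit.HodgeConjecture.CorCM.Census.BlockParity
open Summit.HodgeConjecture.CorCM.Census.Coinvariant

/-! ## `ℚ(ζ₇)`: degree `6`, `β = 2`, exactly `1` face -/

section Zeta7

variable (K : CMField) [IsCyclotomicExtension {7} ℚ (K : Type)]

/-- **`β(ℚ(ζ₇)) = 2`** (cyclic `GalT` of order `6`). [cite: Washington1997, Thm. 2.5] [cite: Milne1999LefschetzClasses, Prop. 2.1] -/
theorem card_block_galT_cyclotomic_seven : Fintype.card (Block (conjT : GalT K)) = 2 := by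
  have hp : Nat.Prime 7 := by norm_num
  haveI := isGalois_of_isCyclotomicExtension_prime (F := (K : Type)) 7
  haveI := isCyclic_galT_of_isCyclotomicExtension_prime (F := (K : Type)) hp
  exact card_block_galT_of_finrank_eq_six (by rw [finrank_of_isCyclotomicExtension_prime (F := (K : Type)) hp])

/-- **`ℚ(ζ₇)`: the least number of generating faces is `1`** (every base embedding `σ₀`). [cite: Pohlmann1968, Thm. 1] -/
theorem isLeast_card_faces_hgen_cyclotomic_seven (σ₀ : (K : Type) →+* ℂ) :
    IsLeast {m : ℕ | ∃ 𝒮 : Finset (Face K), 𝒮.card = m ∧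
      ∀ f : Face K, lefChar f.corner (fun _ => ({σ₀} : Finset ((K : Type) →+* ℂ))) ∈ AddSubgroup.closure
        {a : Asym K | ∃ g ∈ (𝒮 : Set (Face K)), ∃ σ : (K : Type) →+* ℂ, a = lefChar g.corner (fun _ => ({σ} : Finset ((K : Type) →+* ℂ)))}}
      1 := by
  have hp : Nat.Prime 7 := by norm_num
  haveI := isGalois_of_isCyclotomicExtension_prime (F := (K : Type)) 7
  haveI := isCyclic_galT_of_isCyclotomicExtension_prime (F := (K : Type)) hp
  exact isLeast_card_faces_hgen_of_card_block_eq (card_block_galT_cyclotomic_seven K) σ₀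

/-- **HC for the slice of `ℚ(ζ₇)` from `1` face period** (simple CM abelian varieties of dimension `3` with CM by `ℚ(ζ₇)`, their powers,
products and everything they dominate, together with the CM subfields): CONDITIONAL on the periods; `HC_CM` is NOT proved.
[cite: Shimura1998, §6.2 Theorem 3 and §6.1 Corollary of Theorem 2 (pp. 41–43)] [cite: Pohlmann1968, Thm. 1]
[cite: Milne1999LefschetzClasses, Thm. 3.2 and Cor. 4.5] [cite: MumfordAV1970, §19 Thm. 1 and p. 169] -/
theorem hodgeConjectureFor_cyclotomic_seven_of_exists_facePeriod (σ₀ : (K : Type) →+* ℂ) :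
    ∃ 𝒮 : Finset (Face K), 𝒮.card = 1 ∧
      ((∀ f ∈ 𝒮, ∃ ι₁ : K →+* ℂ, f.Admissible ι₁ ∧ ∃ (V : HermSpace3 K ι₁) (σ : K →+* ℂ),
        (Model.picardCMUniverse exists_isReal_hodgeModel_holds hodgePQ_independent_of_hodgeModel_holds
          BallQuotient.ballQuotientUniformised_holds cmAbelianVarietyRealised_holds).PeriodNV ι₁ V K f.psi σ) →
      ∀ {P B : AbelianVariety ℂ}, AbelianVariety.IsProductOf (fun B : AbelianVariety ℂ =>
        ∃ (E : Type) (_ : Field E) (_ : NumberField E) (_ : IsCMField E) (_ : E →+* (K : Type)) (Φ : CMType E)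
          (ι : 𝓞 E →+* End B) (θ : E →+* Module.End ℂ (complexBetti B.X 1)),
          IsCMTypeRealisation Φ B ι θ) P →
      AVDominatedBy B P → HodgeConjectureFor B.dim B.X) := by
  obtain ⟨𝒮, hcard, h⟩ := hodgeConjectureFor_of_isCyclotomicExtension_prime_of_exists_facePeriod K
    (p := 7) (by norm_num) (by norm_num) σ₀
  rw [card_block_galT_cyclotomic_seven K] at hcard
  exact ⟨𝒮, by omega, h⟩

end Zeta7

/-! ## `ℚ(ζ₁₁)`: degree `10`, `β = 4`, exactly `3` faces -/

section Zeta11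

variable (K : CMField) [IsCyclotomicExtension {11} ℚ (K : Type)]

/-- **`β(ℚ(ζ₁₁)) = 4`** (cyclic `GalT` of order `10`). [cite: Washington1997, Thm. 2.5] [cite: Milne1999LefschetzClasses, Prop. 2.1] -/
theorem card_block_galT_cyclotomic_eleven : Fintype.card (Block (conjT : GalT K)) = 4 := by
  have hp : Nat.Prime 11 := by norm_num
  haveI := isGalois_of_isCyclotomicExtension_prime (F := (K : Type)) 11
  haveI := isCyclic_galT_of_isCyclotomicExtension_prime (F := (K : Type)) hp
  exact card_block_galT_of_finrank_eq_ten (by rw [finrank_of_isCyclotomicExtension_prime (F := (K : Type)) hp])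

/-- **`ℚ(ζ₁₁)`: the least number of generating faces is `3`** (every base embedding `σ₀`). [cite: Pohlmann1968, Thm. 1] -/
theorem isLeast_card_faces_hgen_cyclotomic_eleven (σ₀ : (K : Type) →+* ℂ) :
    IsLeast {m : ℕ | ∃ 𝒮 : Finset (Face K), 𝒮.card = m ∧
      ∀ f : Face K, lefChar f.corner (fun _ => ({σ₀} : Finset ((K : Type) →+* ℂ))) ∈ AddSubgroup.closure
        {a : Asym K | ∃ g ∈ (𝒮 : Set (Face K)), ∃ σ : (K : Type) →+* ℂ, a = lefChar g.corner (fun _ => ({σ} : Finset ((K : Type) →+* ℂ)))}}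
      3 := by
  have hp : Nat.Prime 11 := by norm_num
  haveI := isGalois_of_isCyclotomicExtension_prime (F := (K : Type)) 11
  haveI := isCyclic_galT_of_isCyclotomicExtension_prime (F := (K : Type)) hp
  exact isLeast_card_faces_hgen_of_card_block_eq (card_block_galT_cyclotomic_eleven K) σ₀

/-- **HC for the slice of `ℚ(ζ₁₁)` from `3` face periods** (simple CM abelian varieties of dimension `5` with CM by `ℚ(ζ₁₁)`, their powers,
products and everything they dominate, together with the CM subfields): CONDITIONAL on the periods; `HC_CM` is NOT proved.
[cite: Shimura1998, §6.2 Theorem 3 and §6.1 Corollary of Theorem 2 (pp. 41–43)] [cite: Pohlmann1968, Thm. 1]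
[cite: Milne1999LefschetzClasses, Thm. 3.2 and Cor. 4.5] [cite: MumfordAV1970, §19 Thm. 1 and p. 169] -/
theorem hodgeConjectureFor_cyclotomic_eleven_of_exists_facePeriod (σ₀ : (K : Type) →+* ℂ) :
    ∃ 𝒮 : Finset (Face K), 𝒮.card = 3 ∧
      ((∀ f ∈ 𝒮, ∃ ι₁ : K →+* ℂ, f.Admissible ι₁ ∧ ∃ (V : HermSpace3 K ι₁) (σ : K →+* ℂ),
        (Model.picardCMUniverse exists_isReal_hodgeModel_holds hodgePQ_independent_of_hodgeModel_holds
          BallQuotient.ballQuotientUniformised_holds cmAbelianVarietyRealised_holds).PeriodNV ι₁ V K f.psi σ) →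
      ∀ {P B : AbelianVariety ℂ}, AbelianVariety.IsProductOf (fun B : AbelianVariety ℂ =>
        ∃ (E : Type) (_ : Field E) (_ : NumberField E) (_ : IsCMField E) (_ : E →+* (K : Type)) (Φ : CMType E)
          (ι : 𝓞 E →+* End B) (θ : E →+* Module.End ℂ (complexBetti B.X 1)),
          IsCMTypeRealisation Φ B ι θ) P →
      AVDominatedBy B P → HodgeConjectureFor B.dim B.X) := by
  obtain ⟨𝒮, hcard, h⟩ := hodgeConjectureFor_of_isCyclotomicExtension_prime_of_exists_facePeriod K
    (p := 11) (by norm_num) (by norm_num) σ₀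
  rw [card_block_galT_cyclotomic_eleven K] at hcard
  exact ⟨𝒮, by omega, h⟩

end Zeta11

/-! ## `ℚ(ζ₁₃)`: degree `12`, `β = 6`, exactly `5` faces -/

section Zeta13

variable (K : CMField) [IsCyclotomicExtension {13} ℚ (K : Type)]

/-- **`β(ℚ(ζ₁₃)) = 6`** (cyclic `GalT` of order `12`). [cite: Washington1997, Thm. 2.5] [cite: Milne1999LefschetzClasses, Prop. 2.1] -/
theorem card_block_galT_cyclotomic_thirteen : Fintype.card (Block (conjT : GalT K)) = 6 := by
  have hp : Nat.Prime 13 := by norm_num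
  haveI := isGalois_of_isCyclotomicExtension_prime (F := (K : Type)) 13
  haveI := isCyclic_galT_of_isCyclotomicExtension_prime (F := (K : Type)) hp
  exact card_block_galT_of_finrank_eq_twelve (by rw [finrank_of_isCyclotomicExtension_prime (F := (K : Type)) hp])

/-- **`ℚ(ζ₁₃)`: the least number of generating faces is `5`** (every base embedding `σ₀`). [cite: Pohlmann1968, Thm. 1] -/
theorem isLeast_card_faces_hgen_cyclotomic_thirteen (σ₀ : (K : Type) →+* ℂ) :
    IsLeast {m : ℕ | ∃ 𝒮 : Finset (Face K), 𝒮.card = m ∧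
      ∀ f : Face K, lefChar f.corner (fun _ => ({σ₀} : Finset ((K : Type) →+* ℂ))) ∈ AddSubgroup.closure
        {a : Asym K | ∃ g ∈ (𝒮 : Set (Face K)), ∃ σ : (K : Type) →+* ℂ, a = lefChar g.corner (fun _ => ({σ} : Finset ((K : Type) →+* ℂ)))}}
      5 := by
  have hp : Nat.Prime 13 := by norm_num
  haveI := isGalois_of_isCyclotomicExtension_prime (F := (K : Type)) 13
  haveI := isCyclic_galT_of_isCyclotomicExtension_prime (F := (K : Type)) hp
  exact isLeast_card_faces_hgen_of_card_block_eq (card_block_galT_cyclotomic_thirteen K) σ₀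

/-- **HC for the slice of `ℚ(ζ₁₃)` from `5` face periods** (simple CM abelian varieties of dimension `6` with CM by `ℚ(ζ₁₃)`, their powers,
products and everything they dominate, together with the CM subfields): CONDITIONAL on the periods; `HC_CM` is NOT proved.
[cite: Shimura1998, §6.2 Theorem 3 and §6.1 Corollary of Theorem 2 (pp. 41–43)] [cite: Pohlmann1968, Thm. 1]
[cite: Milne1999LefschetzClasses, Thm. 3.2 and Cor. 4.5] [cite: MumfordAV1970, §19 Thm. 1 and p. 169] -/
theorem hodgeConjectureFor_cyclotomic_thirteen_of_exists_facePeriod (σ₀ : (K : Type) →+* ℂ) :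
    ∃ 𝒮 : Finset (Face K), 𝒮.card = 5 ∧
      ((∀ f ∈ 𝒮, ∃ ι₁ : K →+* ℂ, f.Admissible ι₁ ∧ ∃ (V : HermSpace3 K ι₁) (σ : K →+* ℂ),
        (Model.picardCMUniverse exists_isReal_hodgeModel_holds hodgePQ_independent_of_hodgeModel_holds
          BallQuotient.ballQuotientUniformised_holds cmAbelianVarietyRealised_holds).PeriodNV ι₁ V K f.psi σ) →
      ∀ {P B : AbelianVariety ℂ}, AbelianVariety.IsProductOf (fun B : AbelianVariety ℂ =>
        ∃ (E : Type) (_ : Field E) (_ : NumberField E) (_ : IsCMField E) (_ : E →+* (K : Type)) (Φ : CMType E)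
          (ι : 𝓞 E →+* End B) (θ : E →+* Module.End ℂ (complexBetti B.X 1)),
          IsCMTypeRealisation Φ B ι θ) P →
      AVDominatedBy B P → HodgeConjectureFor B.dim B.X) := by
  obtain ⟨𝒮, hcard, h⟩ := hodgeConjectureFor_of_isCyclotomicExtension_prime_of_exists_facePeriod K
    (p := 13) (by norm_num) (by norm_num) σ₀
  rw [card_block_galT_cyclotomic_thirteen K] at hcard
  exact ⟨𝒮, by omega, h⟩

end Zeta13

/-! ## `ℚ(ζ₁₇)`: degree `16`, `β = 16`, exactly `15` faces -/

section Zeta17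

variable (K : CMField) [IsCyclotomicExtension {17} ℚ (K : Type)]

/-- **`β(ℚ(ζ₁₇)) = 16`** (cyclic `GalT` of order `16`). [cite: Washington1997, Thm. 2.5] [cite: Milne1999LefschetzClasses, Prop. 2.1] -/
theorem card_block_galT_cyclotomic_seventeen : Fintype.card (Block (conjT : GalT K)) = 16 := by
  have hp : Nat.Prime 17 := by norm_num
  haveI := isGalois_of_isCyclotomicExtension_prime (F := (K : Type)) 17
  haveI := isCyclic_galT_of_isCyclotomicExtension_prime (F := (K : Type)) hp
  exact card_block_galT_of_finrank_eq_sixteen (by rw [finrank_of_isCyclotomicExtension_prime (F := (K : Type)) hp])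

/-- **`ℚ(ζ₁₇)`: the least number of generating faces is `15`** (every base embedding `σ₀`). [cite: Pohlmann1968, Thm. 1] -/
theorem isLeast_card_faces_hgen_cyclotomic_seventeen (σ₀ : (K : Type) →+* ℂ) :
    IsLeast {m : ℕ | ∃ 𝒮 : Finset (Face K), 𝒮.card = m ∧
      ∀ f : Face K, lefChar f.corner (fun _ => ({σ₀} : Finset ((K : Type) →+* ℂ))) ∈ AddSubgroup.closure
        {a : Asym K | ∃ g ∈ (𝒮 : Set (Face K)), ∃ σ : (K : Type) →+* ℂ, a = lefChar g.corner (fun _ => ({σ} : Finset ((K : Type) →+* ℂ)))}}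
      15 := by
  have hp : Nat.Prime 17 := by norm_num
  haveI := isGalois_of_isCyclotomicExtension_prime (F := (K : Type)) 17
  haveI := isCyclic_galT_of_isCyclotomicExtension_prime (F := (K : Type)) hp
  exact isLeast_card_faces_hgen_of_card_block_eq (card_block_galT_cyclotomic_seventeen K) σ₀

/-- **HC for the slice of `ℚ(ζ₁₇)` from `15` face periods** (simple CM abelian varieties of dimension `8` with CM by `ℚ(ζ₁₇)`, their powers,
products and everything they dominate, together with the CM subfields): CONDITIONAL on the periods; `HC_CM` is NOT proved.
[cite: Shimura1998, §6.2 Theorem 3 and §6.1 Corollary of Theorem 2 (pp. 41–43)] [cite: Pohlmann1968, Thm. 1]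
[cite: Milne1999LefschetzClasses, Thm. 3.2 and Cor. 4.5] [cite: MumfordAV1970, §19 Thm. 1 and p. 169] -/
theorem hodgeConjectureFor_cyclotomic_seventeen_of_exists_facePeriod (σ₀ : (K : Type) →+* ℂ) :
    ∃ 𝒮 : Finset (Face K), 𝒮.card = 15 ∧
      ((∀ f ∈ 𝒮, ∃ ι₁ : K →+* ℂ, f.Admissible ι₁ ∧ ∃ (V : HermSpace3 K ι₁) (σ : K →+* ℂ),
        (Model.picardCMUniverse exists_isReal_hodgeModel_holds hodgePQ_independent_of_hodgeModel_holds
          BallQuotient.ballQuotientUniformised_holds cmAbelianVarietyRealised_holds).PeriodNV ι₁ V K f.psi σ) →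
      ∀ {P B : AbelianVariety ℂ}, AbelianVariety.IsProductOf (fun B : AbelianVariety ℂ =>
        ∃ (E : Type) (_ : Field E) (_ : NumberField E) (_ : IsCMField E) (_ : E →+* (K : Type)) (Φ : CMType E)
          (ι : 𝓞 E →+* End B) (θ : E →+* Module.End ℂ (complexBetti B.X 1)),
          IsCMTypeRealisation Φ B ι θ) P →
      AVDominatedBy B P → HodgeConjectureFor B.dim B.X) := by
  obtain ⟨𝒮, hcard, h⟩ := hodgeConjectureFor_of_isCyclotomicExtension_prime_of_exists_facePeriod K
    (p := 17) (by norm_num) (by norm_num) σ₀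
  rw [card_block_galT_cyclotomic_seventeen K] at hcard
  exact ⟨𝒮, by omega, h⟩

end Zeta17

/-! ## `ℚ(ζ₁₉)`: degree `18`, `β = 30`, exactly `29` faces -/

section Zeta19

variable (K : CMField) [IsCyclotomicExtension {19} ℚ (K : Type)]

/-- **`β(ℚ(ζ₁₉)) = 30`** (cyclic `GalT` of order `18`). [cite: Washington1997, Thm. 2.5] [cite: Milne1999LefschetzClasses, Prop. 2.1] -/
theorem card_block_galT_cyclotomic_nineteen : Fintype.card (Block (conjT : GalT K)) = 30 := by
  have hp : Nat.Prime 19 := by norm_num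
  haveI := isGalois_of_isCyclotomicExtension_prime (F := (K : Type)) 19
  haveI := isCyclic_galT_of_isCyclotomicExtension_prime (F := (K : Type)) hp
  exact card_block_galT_of_finrank_eq_eighteen (by rw [finrank_of_isCyclotomicExtension_prime (F := (K : Type)) hp])

/-- **`ℚ(ζ₁₉)`: the least number of generating faces is `29`** (every base embedding `σ₀`). [cite: Pohlmann1968, Thm. 1] -/
theorem isLeast_card_faces_hgen_cyclotomic_nineteen (σ₀ : (K : Type) →+* ℂ) :
    IsLeast {m : ℕ | ∃ 𝒮 : Finset (Face K), 𝒮.card = m ∧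
      ∀ f : Face K, lefChar f.corner (fun _ => ({σ₀} : Finset ((K : Type) →+* ℂ))) ∈ AddSubgroup.closure
        {a : Asym K | ∃ g ∈ (𝒮 : Set (Face K)), ∃ σ : (K : Type) →+* ℂ, a = lefChar g.corner (fun _ => ({σ} : Finset ((K : Type) →+* ℂ)))}}
      29 := by
  have hp : Nat.Prime 19 := by norm_num
  haveI := isGalois_of_isCyclotomicExtension_prime (F := (K : Type)) 19
  haveI := isCyclic_galT_of_isCyclotomicExtension_prime (F := (K : Type)) hp
  exact isLeast_card_faces_hgen_of_card_block_eq (card_block_galT_cyclotomic_nineteen K) σ₀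

/-- **HC for the slice of `ℚ(ζ₁₉)` from `29` face periods** (simple CM abelian varieties of dimension `9` with CM by `ℚ(ζ₁₉)`, their powers,
products and everything they dominate, together with the CM subfields): CONDITIONAL on the periods; `HC_CM` is NOT proved.
[cite: Shimura1998, §6.2 Theorem 3 and §6.1 Corollary of Theorem 2 (pp. 41–43)] [cite: Pohlmann1968, Thm. 1]
[cite: Milne1999LefschetzClasses, Thm. 3.2 and Cor. 4.5] [cite: MumfordAV1970, §19 Thm. 1 and p. 169] -/
theorem hodgeConjectureFor_cyclotomic_nineteen_of_exists_facePeriod (σ₀ : (K : Type) →+* ℂ) :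
    ∃ 𝒮 : Finset (Face K), 𝒮.card = 29 ∧
      ((∀ f ∈ 𝒮, ∃ ι₁ : K →+* ℂ, f.Admissible ι₁ ∧ ∃ (V : HermSpace3 K ι₁) (σ : K →+* ℂ),
        (Model.picardCMUniverse exists_isReal_hodgeModel_holds hodgePQ_independent_of_hodgeModel_holds
          BallQuotient.ballQuotientUniformised_holds cmAbelianVarietyRealised_holds).PeriodNV ι₁ V K f.psi σ) →
      ∀ {P B : AbelianVariety ℂ}, AbelianVariety.IsProductOf (fun B : AbelianVariety ℂ =>
        ∃ (E : Type) (_ : Field E) (_ : NumberField E) (_ : IsCMField E) (_ : E →+* (K : Type)) (Φ : CMType E)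
          (ι : 𝓞 E →+* End B) (θ : E →+* Module.End ℂ (complexBetti B.X 1)),
          IsCMTypeRealisation Φ B ι θ) P →
      AVDominatedBy B P → HodgeConjectureFor B.dim B.X) := by
  obtain ⟨𝒮, hcard, h⟩ := hodgeConjectureFor_of_isCyclotomicExtension_prime_of_exists_facePeriod K
    (p := 19) (by norm_num) (by norm_num) σ₀
  rw [card_block_galT_cyclotomic_nineteen K] at hcard
  exact ⟨𝒮, by omega, h⟩

end Zeta19

/-! ## `ℚ(ζ₂₃)`: degree `22`, `β = 94`, exactly `93` faces -/

section Zeta23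

variable (K : CMField) [IsCyclotomicExtension {23} ℚ (K : Type)]

/-- **`β(ℚ(ζ₂₃)) = 94`** (cyclic `GalT` of order `22`). [cite: Washington1997, Thm. 2.5] [cite: Milne1999LefschetzClasses, Prop. 2.1] -/
theorem card_block_galT_cyclotomic_twentyThree : Fintype.card (Block (conjT : GalT K)) = 94 := by
  have hp : Nat.Prime 23 := by norm_num
  haveI := isGalois_of_isCyclotomicExtension_prime (F := (K : Type)) 23
  haveI := isCyclic_galT_of_isCyclotomicExtension_prime (F := (K : Type)) hp
  exact card_block_galT_of_finrank_eq_twentyTwo (by rw [finrank_of_isCyclotomicExtension_prime (F := (K : Type)) hp])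

/-- **`ℚ(ζ₂₃)`: the least number of generating faces is `93`** (every base embedding `σ₀`). [cite: Pohlmann1968, Thm. 1] -/
theorem isLeast_card_faces_hgen_cyclotomic_twentyThree (σ₀ : (K : Type) →+* ℂ) :
    IsLeast {m : ℕ | ∃ 𝒮 : Finset (Face K), 𝒮.card = m ∧
      ∀ f : Face K, lefChar f.corner (fun _ => ({σ₀} : Finset ((K : Type) →+* ℂ))) ∈ AddSubgroup.closure
        {a : Asym K | ∃ g ∈ (𝒮 : Set (Face K)), ∃ σ : (K : Type) →+* ℂ, a = lefChar g.corner (fun _ => ({σ} : Finset ((K : Type) →+* ℂ)))}}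
      93 := by
  have hp : Nat.Prime 23 := by norm_num
  haveI := isGalois_of_isCyclotomicExtension_prime (F := (K : Type)) 23
  haveI := isCyclic_galT_of_isCyclotomicExtension_prime (F := (K : Type)) hp
  exact isLeast_card_faces_hgen_of_card_block_eq (card_block_galT_cyclotomic_twentyThree K) σ₀

/-- **HC for the slice of `ℚ(ζ₂₃)` from `93` face periods** (simple CM abelian varieties of dimension `11` with CM by `ℚ(ζ₂₃)`, their powers,
products and everything they dominate, together with the CM subfields): CONDITIONAL on the periods; `HC_CM` is NOT proved.
[cite: Shimura1998, §6.2 Theorem 3 and §6.1 Corollary of Theorem 2 (pp. 41–43)] [cite: Pohlmann1968, Thm. 1]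
[cite: Milne1999LefschetzClasses, Thm. 3.2 and Cor. 4.5] [cite: MumfordAV1970, §19 Thm. 1 and p. 169] -/
theorem hodgeConjectureFor_cyclotomic_twentyThree_of_exists_facePeriod (σ₀ : (K : Type) →+* ℂ) :
    ∃ 𝒮 : Finset (Face K), 𝒮.card = 93 ∧
      ((∀ f ∈ 𝒮, ∃ ι₁ : K →+* ℂ, f.Admissible ι₁ ∧ ∃ (V : HermSpace3 K ι₁) (σ : K →+* ℂ),
        (Model.picardCMUniverse exists_isReal_hodgeModel_holds hodgePQ_independent_of_hodgeModel_holds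
          BallQuotient.ballQuotientUniformised_holds cmAbelianVarietyRealised_holds).PeriodNV ι₁ V K f.psi σ) →
      ∀ {P B : AbelianVariety ℂ}, AbelianVariety.IsProductOf (fun B : AbelianVariety ℂ =>
        ∃ (E : Type) (_ : Field E) (_ : NumberField E) (_ : IsCMField E) (_ : E →+* (K : Type)) (Φ : CMType E)
          (ι : 𝓞 E →+* End B) (θ : E →+* Module.End ℂ (complexBetti B.X 1)),
          IsCMTypeRealisation Φ B ι θ) P →
      AVDominatedBy B P → HodgeConjectureFor B.dim B.X) := by
  obtain ⟨𝒮, hcard, h⟩ := hodgeConjectureFor_of_isCyclotomicExtension_prime_of_exists_facePeriod K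
    (p := 23) (by norm_num) (by norm_num) σ₀
  rw [card_block_galT_cyclotomic_twentyThree K] at hcard
  exact ⟨𝒮, by omega, h⟩

end Zeta23

end Summit.HodgeConjecture.CorCM.FaceCyclic

end
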